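import Summits.QuantumFields.YangMills.Theorems.BalabanLadderIRPinnedExit96
import HarnessLib

/-!
# Pinned cold-pressure onset — the MEET of the two simply-connected bills of record for `BalabanLadder.IR`
# (`ColdExitAt (1/24) ∧ AFToColdPressure ⇒ PinnedOnsetSC ⇐ PinnedExitAt (1/24)`, and `PinnedOnsetSC → IRnsc → IR`)

Helper theorems for crux `Summit.QuantumFields.YangMills.Theses.BalabanLadder.IR` (stmt-QuantumFields-19354), ideator seat
ym-ir-idea-14 gen 3 (LINE B «pinned-exit-96» addendum; crux workfile `Cruxes/IR/Lines/pinned_onset_meet.lean`; critic ym-ir-crit-3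
VERDICT 2026-08-28T07:11:33Z «PASS-AS-FORMAT, width 0 — YES, LAND», with the reading: M is bookkeeping — both bills prove the same pincer
input — and as an attack surface a one-box bill (E/PX) stays preferable).  SORRY-FREE.

HONESTY: nothing in this file proves the Clay Yang–Mills mass gap, a lattice gap, an exit, or `BalabanLadder.IR`; `R4`
(`BalabanUVStability4`) closes only the conditional finite-𝕋⁴ rung `BalabanLadder.UV`.  This file discharges NO Yang–Mills content
(count-neutral FORMAT): it types the weakest simply-connected node through which BOTH registered bills pass.

## Content
* §1 `PinnedOnsetSC` («M»): under the crux's own hypotheses (`a > 0`, `a → 0`, `LowerBounds G r a`) there are `T, β₁` with: for every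
  `β ≥ β₁` SOME cold-pressure length `ξ ≥ 1` is admissible (`ColdPressureAt r.ρ β ξ`) AND pinned to floor units, `a(β)·ξ ≤ T`.
  It drops PX's bounded-volume purity (the pure box may sit at any lattice size) and X's two-point asymptotic freedom.
* §2 the four arrows (all PROVED): `irsc_of_pinnedOnset : M → IRsc` (`cpLength_le` + the landed rate seam
  `gapInUnits_of_coldPressure_pinned`); `pinnedOnset_of_pinnedExit24 : PX → M` (`coldPressureAt_widen_24` at `2¹⁴·L`);
  `pinnedOnset_of_exitAt24 : E(1/24) → X → M` (`coldPressureAt_widen_24` for admissibility, the landed pincer `cp_pinned` for the pin,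
  `cpLength_spec`); `pinnedOnset_of_H24 : H(1/24) → M`.
* §3 the bill `IR_of_meet : M → IRnsc → BalabanLadder.IR` BY NAME; both bills of record factor through M by composition (remark, not
  restated — dedup): the slot {M, N} is weakly dominated by {E(1/24), X, N} and by {PX, N}.
* Not claimed: `M ⇒ PX` (the admissible `ColdPressureAt` carries a β-dependent volume floor `S₁`), `M ⇒ X`.
-/

noncomputable section

open MeasureTheory Filter Topology
open scoped SchwartzMap
open Literature.MathematicalPhysics.QuantumFieldTheory Literature.MathematicalPhysics.QuantumLattice
open Summit.QuantumFields.YangMills.Cruxes.OSLegsFromFemtoAndGap.DlrCollarTransfer (GapInUnits LowerBounds Q2)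
open Summit.QuantumFields.YangMills.Cruxes.IR.ColdPressurePincer
open Summit.QuantumFields.YangMills.Cruxes.IR.ColdPurityBridge
open Summit.QuantumFields.YangMills.Cruxes.IR.BasinRung
open Summit.QuantumFields.YangMills.Cruxes.IR.PinnedExit96

namespace Summit.QuantumFields.YangMills.Cruxes.IR.PinnedOnsetMeet

/-! ## §1 Statement -/

/-- **M = `PinnedOnsetSC`** — pinned cold-pressure onset, simply-connected compact simple `G`.  Under the crux's own hypotheses on the
floor scale `a` (positivity, `a → 0`, `LowerBounds G r a`) there are a pin `T` and a threshold `β₁` such that every `β ≥ β₁` admits SOME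
cold-pressure length `ξ ≥ 1` (`ColdPressureAt r.ρ β ξ`: exponentially small trace excess at rate `1/ξ` on all large cold `4:1` tori) with
`a(β)·ξ ≤ T` (at most `T` floor-lengths).  The MEET of the two simply-connected bills: implied by `ColdExitAt (1/24) ∧ AFToColdPressure`
and by `PinnedExitAt (1/24)`; implies `IRsc`. -/
def PinnedOnsetSC : Prop :=
  ∀ (G : Type) [Group G] [TopologicalSpace G] [IsTopologicalGroup G] [CompactSpace G],
    IsCompactSimpleLieGroup G → SimplyConnectedSpace G →
    letI : MeasurableSpace G := borel G
    haveI : BorelSpace G := ⟨rfl⟩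
    ∀ (r : LatticeRep G) (a : ℝ → ℝ), (∀ β, 0 < a β) → Tendsto a atTop (𝓝 0) → LowerBounds G r a →
      ∃ T β₁ : ℝ, ∀ β : ℝ, β₁ ≤ β → ∃ ξ : ℕ, 1 ≤ ξ ∧ ColdPressureAt r.ρ β ξ ∧ a β * (ξ : ℝ) ≤ T

/-! ## §2 The four arrows -/

/-- **M ⇒ IRsc (PROVED).**  Onset is M's first clause; the pin on the admissible `ξ` pins the least admissible length:
`a β·ξ⋆(β) ≤ a β·ξ ≤ T < T + 1` (`cpLength_le`); the landed rate seam `gapInUnits_of_coldPressure_pinned` concludes. -/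
theorem irsc_of_pinnedOnset (hM : PinnedOnsetSC) : IRsc := by
  intro G _ _ _ _ hG hsc
  letI : MeasurableSpace G := borel G
  haveI : BorelSpace G := ⟨rfl⟩
  intro r a ha ha0 hlb
  obtain ⟨T, β₁, hm⟩ := hM G hG hsc r a ha ha0 hlb
  refine gapInUnits_of_coldPressure_pinned r a ha ha0 (β₂ := β₁) (fun β hβ => ?_) (T := T + 1) (β₆ := β₁) (fun β hβ => ?_)
  · obtain ⟨ξ, h1, h2, -⟩ := hm β hβ
    exact ⟨ξ, h1, h2⟩
  · obtain ⟨ξ, h1, h2, h3⟩ := hm β hβ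
    have hle : (cpLength r.ρ β : ℝ) ≤ (ξ : ℝ) := by exact_mod_cast cpLength_le r.ρ β h1 h2
    have hmul := mul_le_mul_of_nonneg_left hle (ha β).le
    linarith

/-- **PX ⇒ M (PROVED).**  For `β ≥ max β₁ 0` the pinned 96 %-pure box `L` (`a β·L ≤ T`) gives cold pressure at `ξ = 2¹⁴·L`
(`coldPressureAt_widen_24`), pinned with `T' = 2¹⁴·T`. -/
theorem pinnedOnset_of_pinnedExit24 (hP : PinnedExitAt (1 / 24)) : PinnedOnsetSC := by
  intro G _ _ _ _ hG hsc
  letI : MeasurableSpace G := borel G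
  haveI : BorelSpace G := ⟨rfl⟩
  intro r a ha ha0 hlb
  obtain ⟨T, β₁, hpx⟩ := hP G hG hsc r a ha ha0 hlb
  refine ⟨16384 * T, max β₁ 0, fun β hβ => ?_⟩
  have hβ1 : β₁ ≤ β := le_trans (le_max_left _ _) hβ
  have hβ0 : (0 : ℝ) ≤ β := le_trans (le_max_right _ _) hβ
  obtain ⟨L, hL8, hpin, hδ⟩ := hpx β hβ1
  refine ⟨16384 * L, by omega, coldPressureAt_widen_24 r hβ0 hL8 hδ, ?_⟩
  have : a β * ((16384 * L : ℕ) : ℝ) = 16384 * (a β * (L : ℝ)) := by push_cast; ring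
  rw [this]
  linarith

/-- PX at any tolerance `θ ≤ 1/24` ⇒ M. -/
theorem pinnedOnset_of_pinnedExit_le {θ : ℝ} (hθ : θ ≤ 1 / 24) (hP : PinnedExitAt θ) : PinnedOnsetSC :=
  pinnedOnset_of_pinnedExit24 fun G _ _ _ _ hG hsc r a ha ha0 hlb => by
    obtain ⟨T, β₁, h⟩ := hP G hG hsc r a ha ha0 hlb
    exact ⟨T, β₁, fun β hβ => by obtain ⟨L, h8, hp, hd⟩ := h β hβ; exact ⟨L, h8, hp, hd.trans hθ⟩⟩

/-- **E(1/24) ∧ X ⇒ M (PROVED).**  For `β ≥ max (max β₁ 0) β₆`: the exit box `L` of `ColdExitAt (1/24)` makes `2¹⁴·L` admissible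
(`coldPressureAt_widen_24`), so the least admissible length `ξ⋆(β)` is admissible and `≥ 1` (`cpLength_spec`); the landed pincer
`cp_pinned` (from `LowerBounds` and `AFToColdPressure`) gives `a β·ξ⋆(β) < T`.  Take `ξ := ξ⋆(β)`. -/
theorem pinnedOnset_of_exitAt24 (hE : ColdExitAt (1 / 24)) (hX : AFToColdPressure) : PinnedOnsetSC := by
  intro G _ _ _ _ hG hsc
  letI : MeasurableSpace G := borel G
  haveI : BorelSpace G := ⟨rfl⟩
  intro r a ha ha0 hlb
  obtain ⟨β₁, hex⟩ := hE G hG hsc r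
  obtain ⟨T, β₆, hpin⟩ := cp_pinned r a ha hlb (hX G hG r)
  refine ⟨T, max (max β₁ 0) β₆, fun β hβ => ?_⟩
  have hβ1 : β₁ ≤ β := le_trans (le_trans (le_max_left _ _) (le_max_left _ _)) hβ
  have hβ0 : (0 : ℝ) ≤ β := le_trans (le_trans (le_max_right _ _) (le_max_left _ _)) hβ
  have hβ6 : β₆ ≤ β := le_trans (le_max_right _ _) hβ
  obtain ⟨L, hL8, hδ⟩ := hex β hβ1
  have hadm : ColdPressureAt r.ρ β (16384 * L) := coldPressureAt_widen_24 r hβ0 hL8 hδ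
  have hne : (cpSet r.ρ β).Nonempty := ⟨16384 * L, by omega, hadm⟩
  obtain ⟨h1, h2⟩ := cpLength_spec r.ρ β hne
  exact ⟨cpLength r.ρ β, h1, h2, (hpin β hβ6).le⟩

/-- **H(1/24) ⇒ M (PROVED)** — the handshake bill factors through M as well (`pinnedExit_of_floorToPurityAt`). -/
theorem pinnedOnset_of_H24 (hH : FloorToPurityAt (1 / 24)) : PinnedOnsetSC :=
  pinnedOnset_of_pinnedExit24 (pinnedExit_of_floorToPurityAt hH)

/-- `FloorToPuritySC` (H with the tolerance quantified) ⇒ M. -/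
theorem pinnedOnset_of_floorToPuritySC (hH : FloorToPuritySC) : PinnedOnsetSC :=
  pinnedOnset_of_H24 (rebaseH_iff.mpr hH)

/-! ## §3 The bill through the meet, and both bills of record recovered through it -/

/-- **The meet bill `IR_of_meet : M → N → IR` BY NAME (PROVED composition; `IR_of_cases` is the tree's).** -/
theorem IR_of_meet (hM : PinnedOnsetSC) (hN : IRnsc) : Summit.QuantumFields.YangMills.Theses.BalabanLadder.IR :=
  IR_of_cases (irsc_of_pinnedOnset hM) hN

/-! Both bills of record FACTOR THROUGH M by composition — `IR_of_meet (pinnedOnset_of_exitAt24 hE hX) hN` has the type of the landed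
`BasinRung.IR_of_exitAt24`, `IR_of_meet (pinnedOnset_of_pinnedExit24 hP) hN` that of `PinnedExit96.IR_of`, and `IR_of_meet (pinnedOnset_of_H24 hH) hN`
that of `PinnedExit96.IR_of_H24`; they are NOT restated as theorems here (the gate's `dedup.landed`; named copies live in the crux workfile
`Cruxes/IR/Lines/pinned_onset_meet.lean`), but kernel-checked as `example`s: the certificate that the slot {M, N} is weakly dominated by
{E(1/24), X, N}, by {PX, N} and by {H, N}. -/

example (hE : ColdExitAt (1 / 24)) (hX : AFToColdPressure) (hN : IRnsc) : Summit.QuantumFields.YangMills.Theses.BalabanLadder.IR :=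
  IR_of_meet (pinnedOnset_of_exitAt24 hE hX) hN

example (hP : PinnedExitAt (1 / 24)) (hN : IRnsc) : Summit.QuantumFields.YangMills.Theses.BalabanLadder.IR :=
  IR_of_meet (pinnedOnset_of_pinnedExit24 hP) hN

example (hH : FloorToPurityAt (1 / 24)) (hN : IRnsc) : Summit.QuantumFields.YangMills.Theses.BalabanLadder.IR :=
  IR_of_meet (pinnedOnset_of_H24 hH) hN

end Summit.QuantumFields.YangMills.Cruxes.IR.PinnedOnsetMeet

end
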